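import Literature.IUT.HodgeArakelov.AbsTopMonoidsGenuineProducer
import Literature.AnabelianGeometry.AbsoluteAnabelian.GaloisPadicLogMLF
import Literature.NumberTheory.GaloisRepresentations.PadicAlgebraOfLocalField
import HarnessLib

/-!
# Jannsen–Wingberg «Dehn twist» automorphisms of `G_k` act on `k_+` by ELEMENTARY TRANSVECTIONS (named fact)

K. Kondo, *Anabelian aspects of the outer automorphism groups of the absolute Galois groups of
mixed-characteristic local fields*, arXiv:2512.09231 (2025) [Kondo2025OuterAutMLF], §2: Theorem 2.1 (the
Jannsen–Wingberg presentation of a group of MLF-type with odd residue characteristic — J. Neukirch, A. Schmidt,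
K. Wingberg, *Cohomology of Number Fields*, 2nd ed. (2008), Theorem 7.5.14 [NeukirchSchmidtWingberg2008]: topological
generators `σ, τ, x_0, …, x_d`, `d = [k : ℚ_p]`, subject to `στσ⁻¹ = τ^{p^f}` and ONE further relation
`σ x_0 σ⁻¹ = (x_0')^t x_1^{p^s} [x_1,x_2][x_3,x_4]⋯[x_{d−1},x_d]` (d even) resp.
`… x_1^{p^s}[x_1,x_1'][x_2,x_3]⋯[x_{d−1},x_d]` (d odd)), and the PROOF of Theorem 2.3, p. 10: for `d ≥ 3` and each
twist pair `(a_i, b_i) = (x_{2i+1}, x_{2i+2})` (d even) resp. `(x_{2i}, x_{2i+1})` (d odd), «it follows from Theorem 2.1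
that there exist automorphisms `φ_i`, `φ'_i` of `G_k`» with `φ_i(b_i) = b_i a_i`, `φ'_i(a_i) = a_i b_i⁻¹`, all other
generators fixed, and their induced automorphisms of the `ℚ_p`-vector space `k_+` — «induced from `φ` by the
mono-anabelian reconstruction algorithm», i.e. through `G_k^{ab} ≅ k^×^ ⊇ 𝒪_k^×` and the `p`-adic logarithm
`log_k : 𝒪_k^× → k_+` (Kondo, Introduction, the map `F`) — satisfy `(φ_i)_+(v) − v = e_i·y_{2i+1}`,
`(φ'_i)_+(v) − v = −c_i·y_{2i+2}` (`c_i, e_i` the coefficients of `v` at `y_{2i+1}, y_{2i+2}`), where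
`y_j := log_k(rec_k⁻¹(x̄_j))` and `y_1, …, y_d` is a `ℚ_p`-BASIS of `k_+` (Y. Hoshi, Y. Nishio, *On the outer
automorphism groups of the absolute Galois groups of mixed-characteristic local fields*, Res. Number Theory 8 (2022)
[HoshiNishio2022OuterAutMLF], Lemma 1.3; Kondo §2 after Thm. 2.1).  In words: `(φ_i)_+` is the elementary
transvection `y_b ↦ y_b + y_a` and `(φ'_i)_+` is `y_a ↦ y_a − y_b` of the twist plane `(y_a, y_b)`.

TYPED HERE, in the tree's vocabulary (abc-iut cell, seat abc-iut-c312-1 gen 9; GAP-LEDGER row G-c312-1-g9-1), as the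
named fact `DehnTwistTransvections`, for an MLF with an algebraic closure `C : MLFClosure` (abc-iut-L4-t2):
* «induced by the mono-anabelian reconstruction algorithm» = through THE `φ`-equivariant lift
  `AbsTopMonoids.Genuine.liftM C φ` of `φ ∈ Aut_top(G_k)` to `𝒪_k̄^⊳` (abc-iut-L6-t13, [AbsTopIII] Prop. 3.2 (iv);
  = the units transport `Art⁻¹ ∘ φ^{ab} ∘ Art` of [AbsAnab] Prop. 1.2.1 (vi) on base units by the tree's
  `MLFClosure.liftM_coe_eq_of_unitsTransport` / `Prop121vii.levelwise_of_isAlphaEquivariant`), read on base units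
  `u ∈ 𝒪_k^× ⊆ 𝒪_k̄^⊳` through the logarithm `log_k̄` of [AbsTopIII] Def. 3.1 (i) (`MLFClosure.galoisPadicLogOfResidueChar`,
  abc-iut-L6-d2), which restricts to `log_k` on `k` — the predicate `MLFClosure.LiftActsOnLogAs C φ T`;
* the `ℚ_p`-structure of `k` = the tree's canonical `LocalField.padicAlgebra`.
WEAKENED to what the consumer needs (`-- TODO(general form)` below): SOME `ℚ_p`-basis `y` of `k` and SOME pair
`a ≠ b` of indices carrying both transvections (print: every pair `(2i+1, 2i+2)` resp. `(2i, 2i+1)`,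
`1 ≤ i ≤ ⌊(d−2)/2⌋` resp. `(d−1)/2`, of ONE basis).  Consumer: abc-iut-c312-1's
`Summit.ABC.IUTFork.Thm311.Real.exists_mem_ind1StripOf_image_closedBall_ne` (the (Ind1)-strip MOVER at
`f(v|p) = 1`), whose binders this fact discharges once bridged to `Real.liftUnits`.  A classical result about the
absolute Galois group of a `p`-adic field; nothing here bears on [IUTchIII] Cor. 3.12; no side taken.
-/

noncomputable section

namespace Literature.AnabelianGeometry.AbsoluteAnabelian

open Literature.IUT.HodgeArakelov Literature.NumberTheory.GaloisRepresentations ValuativeRel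
open scoped ValuativeRel

namespace MLFClosure

/-- **`φ ∈ Aut_top(G_k)` acts on `k_+` as `T`** (through the mono-anabelian transport): whenever THE
`φ`-equivariant lift `liftM C φ` of [AbsTopIII] Prop. 3.2 (iv) carries a base unit `u ∈ 𝒪_k^× ⊆ 𝒪_k̄^⊳` to the base
unit `u'`, and `t = log_k u`, `t' = log_k u'` in `k` (read through `log_k̄`, [AbsTopIII] Def. 3.1 (i), at the residue
characteristic `p`), then `t' = T t`.  This is Kondo's `φ_+ = T` («the automorphism of `k_+` induced from `φ` by the
mono-anabelian reconstruction algorithm», arXiv:2512.09231 §0 «Groups of MLF-type» / §2).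
[cite: Kondo2025OuterAutMLF, §2 proof of Thm 2.3 p.10] -/
def LiftActsOnLogAs (C : MLFClosure.{0}) (p : ℕ) [Fact p.Prime] (hp : valuation C.k p < 1)
    (φ : (ModelMLFGaloisData.galois C.k C.K).tmPair.Pi ≃ₜ* (ModelMLFGaloisData.galois C.k C.K).tmPair.Pi)
    (T : C.k → C.k) : Prop :=
  ∀ (x x' : (ModelMLFGaloisData.galois C.k C.K).tmPair.M) (u u' t t' : C.k),
    ((x : nonzeroIntegers C.k C.K) : C.K) = algebraMap C.k C.K u →
    ((x' : nonzeroIntegers C.k C.K) : C.K) = algebraMap C.k C.K u' →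
    AbsTopMonoids.Genuine.liftM C φ x = x' →
    (C.galoisPadicLogOfResidueChar p hp).log (algebraMap C.k C.K u) = algebraMap C.k C.K t →
    (C.galoisPadicLogOfResidueChar p hp).log (algebraMap C.k C.K u') = algebraMap C.k C.K t' →
    t' = T t

end MLFClosure

/-- **Jannsen–Wingberg twist transvections** (Kondo, arXiv:2512.09231, §2: Thm. 2.1 = NSW Thm. 7.5.14, and the
automorphisms `φ_i : b_i ↦ b_i a_i`, `φ'_i : a_i ↦ a_i b_i⁻¹` in the proof of Thm. 2.3, p. 10, with
`(φ_i)_+(v) − v = e_i y_{2i+1}`, `(φ'_i)_+(v) − v = −c_i y_{2i+2}` in the `ℚ_p`-basis `y_j = log_k rec_k⁻¹(x̄_j)` of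
`k_+`, Hoshi–Nishio 2022 Lemma 1.3): for every MLF `k` with ODD residue characteristic `p` and `[k : ℚ_p] ≥ 3`, with
any algebraic closure `k̄`, there are a `ℚ_p`-basis `y` of `k` and indices `a ≠ b` such that SOME topological
automorphism `φ` of `G_k = Gal(k̄/k)` acts on `k_+` (through THE equivariant lift and `log`) as the elementary
transvection `t ↦ t + y^*_b(t)·y_a` (`y_b ↦ y_b + y_a`), and SOME `φ'` as `t ↦ t − y^*_a(t)·y_b` (`y_a ↦ y_a − y_b`).
-- TODO(general form): Kondo gives this for EVERY twist pair `(2i+1, 2i+2)` (d even) / `(2i, 2i+1)` (d odd) of ONE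
-- basis coming from the Jannsen–Wingberg generators; only one pair is recorded here.
[cite: Kondo2025OuterAutMLF, §2 Thm 2.1 and proof of Thm 2.3 p.10] [cite: NeukirchSchmidtWingberg2008, Thm 7.5.14]
[cite: HoshiNishio2022OuterAutMLF, Lemma 1.3] -/
def DehnTwistTransvections : Prop :=
  ∀ (C : MLFClosure.{0}) (p : ℕ) [Fact p.Prime] (hp : valuation C.k p < 1), p ≠ 2 →
    letI : Algebra ℚ_[p] C.k := LocalField.padicAlgebra C.k p hp
    3 ≤ Module.finrank ℚ_[p] C.k →
      ∃ (n : ℕ) (y : Module.Basis (Fin n) ℚ_[p] C.k) (a b : Fin n), a ≠ b ∧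
        (∃ φ : (ModelMLFGaloisData.galois C.k C.K).tmPair.Pi ≃ₜ* (ModelMLFGaloisData.galois C.k C.K).tmPair.Pi,
          C.LiftActsOnLogAs p hp φ fun t => t + y.coord b t • y a) ∧
        (∃ φ' : (ModelMLFGaloisData.galois C.k C.K).tmPair.Pi ≃ₜ* (ModelMLFGaloisData.galois C.k C.K).tmPair.Pi,
          C.LiftActsOnLogAs p hp φ' fun t => t - y.coord a t • y b)

/-! ## Correction (gen 9, same session): restriction to UNITS

ERRATUM (self-reported by the author, abc-iut-c312-1 gen 9).  The predicate `MLFClosure.LiftActsOnLogAs` above quantifies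
over ALL base elements `x` of `𝒪_k̄^⊳` coming from `k` — including NON-units (uniformizers) — and reads them through the
tree's logarithm `log_k̄`, which is the IWASAWA logarithm (`padicLogAlgCl`, `log p = 0`), meaningful off `𝒪^×`.  The source
(Kondo §2; Hoshi–Nishio Lemma 1.3) speaks ONLY of `k_+ = (𝒪_k^×)^{pf}`, i.e. of UNITS: it proves nothing about
`log_Iw(φ^×(π))` for a uniformizer `π`.  Hence the named fact `DehnTwistTransvections` above is STRONGER than print and must
NOT be consumed (it is not claimed to be a published result; it may well be false).  The faithful rendering is
`DehnTwistTransvectionsOnUnits` below, over the unit-restricted predicate `MLFClosure.LiftActsOnUnitLogAs`; the consumer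
(`Summit.ABC.IUTFork.Thm311.Real.exists_mem_ind1StripOf_galoisLog_image_closedBall_ne_of_dehnTwists`) only ever used the
predicate at units and is re-derived from the corrected fact in `Thm311RealInd1StripTwistMoverJWUnits`. -/

namespace MLFClosure

/-- **`φ ∈ Aut_top(G_k)` acts on `k_+ = (𝒪_k^×)^{pf} ⊗ ℚ` as `T`** — UNIT-RESTRICTED form (the faithful one): whenever THE
`φ`-equivariant lift `liftM C φ` carries a base UNIT `u ∈ 𝒪_k^×` (`x` a unit of the monoid `𝒪_k̄^⊳`) to `u'`, and
`t = log_k u`, `t' = log_k u'` in `k`, then `t' = T t`.  This is Kondo's `φ_+ = T` on `k_+` («induced from `φ` by the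
mono-anabelian reconstruction algorithm», arXiv:2512.09231 §0/§2), which concerns units only.
[cite: Kondo2025OuterAutMLF, §2 proof of Thm 2.3 p.10] -/
def LiftActsOnUnitLogAs (C : MLFClosure.{0}) (p : ℕ) [Fact p.Prime] (hp : valuation C.k p < 1)
    (φ : (ModelMLFGaloisData.galois C.k C.K).tmPair.Pi ≃ₜ* (ModelMLFGaloisData.galois C.k C.K).tmPair.Pi)
    (T : C.k → C.k) : Prop :=
  ∀ (x x' : (ModelMLFGaloisData.galois C.k C.K).tmPair.M) (u u' t t' : C.k), IsUnit x →
    ((x : nonzeroIntegers C.k C.K) : C.K) = algebraMap C.k C.K u →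
    ((x' : nonzeroIntegers C.k C.K) : C.K) = algebraMap C.k C.K u' →
    AbsTopMonoids.Genuine.liftM C φ x = x' →
    (C.galoisPadicLogOfResidueChar p hp).log (algebraMap C.k C.K u) = algebraMap C.k C.K t →
    (C.galoisPadicLogOfResidueChar p hp).log (algebraMap C.k C.K u') = algebraMap C.k C.K t' →
    t' = T t

end MLFClosure

/-- **Jannsen–Wingberg twist transvections — FAITHFUL (unit-restricted) form** (Kondo, arXiv:2512.09231, §2: Thm. 2.1 =
NSW Thm. 7.5.14, and the automorphisms `φ_i : b_i ↦ b_i a_i`, `φ'_i : a_i ↦ a_i b_i⁻¹` in the proof of Thm. 2.3, p. 10,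
with `(φ_i)_+(v) − v = e_i y_{2i+1}`, `(φ'_i)_+(v) − v = −c_i y_{2i+2}` in the `ℚ_p`-basis `y_j = log_k rec_k⁻¹(x̄_j)` of
`k_+ = (𝒪_k^×)^{pf} ⊗ ℚ`, Hoshi–Nishio 2022 Lemma 1.3): for every MLF `k` with ODD residue characteristic `p` and
`[k : ℚ_p] ≥ 3`, with any algebraic closure, there are a `ℚ_p`-basis `y` of `k` and indices `a ≠ b` such that SOME
topological automorphism `φ` of `G_k` acts on the logarithms of UNITS (through THE equivariant lift) as the elementary
transvection `t ↦ t + y^*_b(t)·y_a`, and SOME `φ'` as `t ↦ t − y^*_a(t)·y_b`.  Supersedes `DehnTwistTransvections`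
(over-quantified, see the Correction note).
-- TODO(general form): Kondo gives this for EVERY twist pair `(2i+1, 2i+2)` (d even) / `(2i, 2i+1)` (d odd) of ONE
-- basis coming from the Jannsen–Wingberg generators; only one pair is recorded here.
[cite: Kondo2025OuterAutMLF, §2 Thm 2.1 and proof of Thm 2.3 p.10] [cite: NeukirchSchmidtWingberg2008, Thm 7.5.14]
[cite: HoshiNishio2022OuterAutMLF, Lemma 1.3] -/
def DehnTwistTransvectionsOnUnits : Prop :=
  ∀ (C : MLFClosure.{0}) (p : ℕ) [Fact p.Prime] (hp : valuation C.k p < 1), p ≠ 2 →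
    letI : Algebra ℚ_[p] C.k := LocalField.padicAlgebra C.k p hp
    3 ≤ Module.finrank ℚ_[p] C.k →
      ∃ (n : ℕ) (y : Module.Basis (Fin n) ℚ_[p] C.k) (a b : Fin n), a ≠ b ∧
        (∃ φ : (ModelMLFGaloisData.galois C.k C.K).tmPair.Pi ≃ₜ* (ModelMLFGaloisData.galois C.k C.K).tmPair.Pi,
          C.LiftActsOnUnitLogAs p hp φ fun t => t + y.coord b t • y a) ∧
        (∃ φ' : (ModelMLFGaloisData.galois C.k C.K).tmPair.Pi ≃ₜ* (ModelMLFGaloisData.galois C.k C.K).tmPair.Pi,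
          C.LiftActsOnUnitLogAs p hp φ' fun t => t - y.coord a t • y b)

/-- **Jannsen–Wingberg twist transvections — ALL PLANES of ONE basis** (the full content of Kondo, arXiv:2512.09231, §2,
proof of Thm. 2.3 p. 10, unit-restricted as in `DehnTwistTransvectionsOnUnits`): for every MLF `k` with ODD residue
characteristic `p` and `d = [k : ℚ_p] ≥ 3`, with any algebraic closure, there is a `ℚ_p`-basis of `k` indexed by
`Fin c ⊕ Fin g × Fin 2` with `c ≤ 2` (print: Kondo's `y_1, …, y_d`, `d = c + 2g`, `c = 2` for `d` even, `c = 1` for `d`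
odd; `g` = the number of commutators free of `x_1` in the Jannsen–Wingberg relation; plane `i` = `(y (inr (i,0)), y (inr (i,1)))`
= Kondo's `(a_{i+1}, b_{i+1})`) such that EVERY plane carries BOTH elementary transvections realised by topological
automorphisms of `G_k` through THE equivariant lift on unit logarithms: `φ_i : y_{(i,1)} ↦ y_{(i,1)} + y_{(i,0)}` and
`φ'_i : y_{(i,0)} ↦ y_{(i,0)} − y_{(i,1)}`.  (Needed for the all-planes parity obstruction `f` odd, `e ≥ 3`; the
one-pair fact `DehnTwistTransvectionsOnUnits` is its consequence.)
[cite: Kondo2025OuterAutMLF, §2 Thm 2.1 and proof of Thm 2.3 p.10] [cite: NeukirchSchmidtWingberg2008, Thm 7.5.14]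
[cite: HoshiNishio2022OuterAutMLF, Lemma 1.3] -/
def DehnTwistTransvectionsOnUnitsAll : Prop :=
  ∀ (C : MLFClosure.{0}) (p : ℕ) [Fact p.Prime] (hp : valuation C.k p < 1), p ≠ 2 →
    letI : Algebra ℚ_[p] C.k := LocalField.padicAlgebra C.k p hp
    3 ≤ Module.finrank ℚ_[p] C.k →
      ∃ (c g : ℕ) (_ : c ≤ 2) (y : Module.Basis (Fin c ⊕ Fin g × Fin 2) ℚ_[p] C.k),
        ∀ i : Fin g,
          (∃ φ : (ModelMLFGaloisData.galois C.k C.K).tmPair.Pi ≃ₜ* (ModelMLFGaloisData.galois C.k C.K).tmPair.Pi,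
            C.LiftActsOnUnitLogAs p hp φ fun t =>
              t + y.coord (Sum.inr (i, 1)) t • y (Sum.inr (i, 0))) ∧
          (∃ φ' : (ModelMLFGaloisData.galois C.k C.K).tmPair.Pi ≃ₜ* (ModelMLFGaloisData.galois C.k C.K).tmPair.Pi,
            C.LiftActsOnUnitLogAs p hp φ' fun t =>
              t - y.coord (Sum.inr (i, 0)) t • y (Sum.inr (i, 1)))

end Literature.AnabelianGeometry.AbsoluteAnabelian

end
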